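/-
Copyright: cell `langlands-arthur-audit` (papers/Langlands/langlands-arthur-audit), unit `pub-arthur-carver` (gen 5).
Staged for the tree under `Literature/NumberTheory/Automorphic/KMSW2014/` (LEAN-IN-TREE rule 2026-08-18);
companion of `KMSW2014/DependencyDag.lean` (tree, p176227 / p176926 / p177283) — imports it and refines its
chapter edges `E_Glob`, `E_Ch2`, `E_Ch3`, `E_Ch4lir`, `E_Ch4loc`, `E_Ch5` to the level of numbered results.
v1.1 (unit `pub-arthur-up-g7`, UPSTREAM TRACER gen 7): first-hand PREMISE AUDIT of every fine edge against the held
TeX (cell GAPS §UP-g7 G-UP-71…G-UP-80; audit files `pub-arthur-up-g7/audit/`): seven premise ADDITIONS among existing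
nodes (`KF26 += MokMain, Transfer`; `KF27 += K24`; `KF29 += Ch1`; `KF35 += GL_inner, Transfer`; `KF37 += IH`;
`KF45 += TF_analytic`; `KF46 += TF_analytic`), each with its locus in the edge docstring; the scope sentence of
Prop* 3.5.3 corrected (the "ψ_{M,+} generic" assumption of chap3.tex l.378 is removed at l.391); composition
theorems re-threaded; no node, leaf, reading or status word added or removed.
-/
import Literature.NumberTheory.Automorphic.KMSW2014.DependencyDag

/-!
# Kaletha–Minguez–Shin–White (2014) — result-level refinement of Chapters 2–5 of the dependency DAG

**Source reproduced.** T. Kaletha, A. Minguez, S. W. Shin, P.-J. White, *Endoscopic classification of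
representations: inner forms of unitary groups*, arXiv:1409.3731v3 [claim: KalethaMinguezShinWhite2014,
under-review] — ONLY the logical structure "result X of §a.b is derived from results Y, Z, the induction
hypothesis and external input L", read FIRST-HAND from the held TeX source (cell inputs
`inputs/files/src/1409.3731/{chap2,chap3,chap4,chap6,main,macros}.tex`; loci `[chapK.tex l.N]`).
Numbering: theorem-like environments share one counter within a subsection (macros.tex l.138-166),
`\setcounter{section}{-1}` makes chap0 = §0 (main.tex l.101), chap6.tex is §5 and the appendix is §A; the
numbers below were generated from the source counters and checked against the PDF outline
(e.g. §2.9 = `sec:lirexp` "A proof of the local intertwining relation in a special case", Prop 2.9.1 =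
`pro:u31lir`, chap2.tex l.1019).

**Star convention (scope).** "We marked each main theorem as well as some lemmas and propositions with
symbol $*$ to indicate that the theorem, lemma, or proposition is only partially proven in this paper and
to be completed in the next two papers" (main.tex l.65).  A starred item enters a waypoint ONLY in the
scope proved here: Lemma* 2.2.3 (p-adic, ψ = φ generic, "We assume that E/F is an extension of fields.
The case where E/F is a split algebra … will be treated in [KMS_B]" chap2.tex l.100); Lemma* 2.2.4 is
formulated only ("postpone the proof to [KMS_A]" l.111); Lemmas* 2.7.1, 2.7.2 for E/F a field (l.669);
Prop* 3.5.3 "in the special case of global pure inner twists of unitary groups" (chap3.tex l.378: "We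
postpone the general proof of this proposition to \cite{KMS_B}. Presently, we will give the proof in the special
case of global pure inner twists of unitary groups"; the further assumption made there — "Moreover we temporarily
assume that $\psi_{M,+}$ … is a generic parameter" — is REMOVED at l.391: "Now we drop the assumption that
$\psi_{M,+}$ is generic … Then the above argument still goes through", so the proved case is: z_+ = 1, any
ψ_{M*} ∈ Ψ₂(M*); v1.0's gloss "[with] ψ_{M,+} generic" was a reading slip, cell DIVERGENCE D-UP-16);
Theorem* 2.6.2 for bounded parameters, E/F a field (chap4.tex l.1096, l.1313, l.1346);
Theorem* 1.6.1 for generic parameters (l.1764); Theorem 5.0.1 under its two assumptions (chap6.tex l.10-15).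
The coarse nodes `LIRg`, `T161g`, `T171p`, `Full` and the deferral edge `E_Full` of the companion are
unchanged.

**What is formalised.**  `Waypoints` — one `Nat → Prop` per result-bearing subsection of Chapters 2, 3,
4 and 5 (ids K22–K29, K31–K38, K41–K49, K50; cell LEMMAS.md §8b), arbitrary; `KF…` — the fine edges
with their loci; `KR…` — the readings "waypoints of a block ⟹ the coarse output node"
(`Ch2 N`, `Ch3 N`, `Glob N`, `LIRg N`, `T161g N`, `T171p N`); the bundles `FineEdges`, `Readings`; the
theorems that the fine edges COMPOSE to the coarse edges `E_Ch3`, `E_Ch4lir`, `E_Ch4loc`, `E_Ch5`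
EXACTLY (`ch3_of_fine`, `lir_of_fine`, `loc_of_fine`, `ch5_of_fine`) and to the forms `E_Ch2Sharp`,
`E_GlobPlus` for Chapter 2 and §§4.1–4.4 (next paragraph); and `scope_of_leaves_fine` /
`full_of_leaves_fine`: the paper's induction re-run on the fine edges from `E_Ch1`, the supply edges and
EXACTLY the leaf bundles `ImportedLeaves`, `PublishedLeaves`, `UnwrittenLeaves` (`UnwrittenSequels` for
`Full`) of the companion — the refinement introduces no new leaf.  External published inputs cited inside
a section ([ArtIOR1], [KZ79], [KS88], [ArtETC], [ArtLCR], [ArtUAR2], [Mul89] ↦ `TF_analytic`; [Hen10],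
[Tate], [LanArt], [Kal13], [GGP12], [KotSign], [Kot86] ↦ `EPIT_published`; [LS87], [KS99], [Lan89],
[LanRice], Shelstad ↦ `Transfer`; [Shi12] ↦ `Glob_inputs`; "[Arthur, x.y.z]" invoked by reference ↦
`Ar_args`; the Mok imports of §1.5 ↦ `MokMain`) are absorbed in the nearest coarse leaf exactly as the
companion's node docstrings assign them, and named in the edge docstrings.

**The one cross-chapter loop, at result level.**  Chapter 2 needs Chapter 4 only through Lemma 4.2.3
(Lemma* 2.2.3 "we pass to a global situation by applying Lemma [4.2.3]" chap2.tex l.104), whose own inputs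
are Chapter 1 and [Shi12, Thm 4.8]; §4.4 needs Chapter 2 through Prop 2.9.1 (Prop 4.4.6: "Condition 5
just stated implies condition 5 of the proposition by Proposition [2.9.1]" chap4.tex l.889) and §4.6 again
(l.1207).  The coarse DAG cut this by `E_Ch2 ⇐ Glob N` with Prop 2.9.1 absorbed into published leaves
(companion `E_Glob` docstring; cell GAPS G-UP-51, G-CV-g4-3).  Here the order inside rank N is the
printed one — K41, K42, K43, then K22 … K29, then K44 — so `KF22` consumes the waypoint `K42` and `KF44`
the output `Ch2 N`; accordingly the Chapter-2 edges compose to `E_Ch2Sharp` (= `E_Ch2` with `Glob N`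
replaced by `Glob_inputs`) and the §§4.1–4.4 edges to `E_GlobPlus` (= `E_Glob` plus the premise `Ch2 N`,
implied by `E_Glob`: `Nodes.globPlus_of_coarse`).  All other cross-block premises are coarse output nodes,
as in `Arthur2013/FineDag.lean`.

**Premise audit (v1.1).**  Standard applied edge by edge (cell GAPS G-UP-71): an input of a subsection is anything
its text invokes for a proof — by `\ref`/`\eqref` (resolved through the source's own labels; a target inside the
same block ⟼ the fine waypoint, a target in another block ⟼ that block's coarse output, Chapter 0/1 ⟼ `Ch1 N`), by
`\cite` (⟼ the coarse leaf of the companion's absorption table), or by prose naming a result or construction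
("the induction hypothesis" ⟼ `IH N`; the quasi-split imports ⟼ `MokMain`; transfer of functions / matching orbital
integrals / transfer factors ⟼ `Transfer`; Eisenstein series, R-groups, trace Paley–Wiener ⟼ `TF_analytic`; the
global theory of GL — residual spectrum, Whittaker models ⟼ `GL_inner`); the typed list is FAITHFUL when every input
is covered by a typed premise.  Forward pointers, roadmap sentences, notational cross-references and the printed
deferrals to [KMS_A]/[KMS_B] (the star convention) are not inputs.  Every `\ref`, `\eqref` and `\cite` of
chap2/3/4/6.tex was listed mechanically per edge (`audit_kmsw_fine.py`, 319 labels, 149 numbered items) and the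
residue read at its line; the additions of v1.1 are the residue that survived, each named at its edge.  Typed
premises WITHOUT a witness in the text (conservative premises, cell LEMMAS §8b.4 (b)(c)(i); `EPIT_published` in
`KF24`; `K22`, `K23` in `KF24`) are kept: an unused premise weakens an edge hypothesis, it cannot make the
bookkeeping over-claim.

**Deliberately not here.**  Chapters 0–1 (coarse `E_Ch1` kept), Appendix A (coarse `E_AppA` kept), the
internal structure of the sequels [KMS_A], [KMS_B]; the content of any waypoint (content statements of
Theorem* 2.6.2 are typed in `Arthur2013/Leaves/InnerLIR.lean`); Mathlib; any claim that a node is true.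
No `axiom`, no `sorry`, no `opaque`: `#print axioms Waypoints.scope_of_leaves_fine` is empty.
-/

set_option autoImplicit false

namespace Literature.NumberTheory.Automorphic.KMSW2014

namespace Nodes

variable (ν : Nodes)

/-- KE4a⁺: the coarse edge `E_Glob` (§§4.1–4.4 ⟹ `Glob N`) with the premise the result-level reading
exposes — `Ch2 N`, through Prop 2.9.1 only (Prop 4.4.6, chap4.tex l.827, l.887-889).  Weaker than
`E_Glob` (`globPlus_of_coarse`). [claim: KalethaMinguezShinWhite2014, under-review] -/
def E_GlobPlus : Prop :=
  ∀ N, ν.IH N → ν.Ch1 N → ν.Ch2 N → ν.MokMain → ν.TF_analytic → ν.Glob_inputs → ν.EPIT_published →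
    ν.Transfer → ν.Ar_args → ν.Glob N

/-- KE2♯: the coarse edge `E_Ch2` with `Glob N` REPLACED by `Glob_inputs` — Chapter 2 uses of Chapter 4
only Lemma 4.2.3 (chap2.tex l.104), which rests on Chapter 1 and [Shi12] (chap4.tex l.133-178).  Neither
implies the other; both imply `E_Ch2Plus`. [claim: KalethaMinguezShinWhite2014, under-review] -/
def E_Ch2Sharp : Prop :=
  ∀ N, ν.IH N → ν.Ch1 N → ν.T164 → ν.MokMain → ν.TF_analytic → ν.Transfer → ν.EPIT_published →
    ν.Ar_args → ν.Glob_inputs → ν.Ch2 N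

/-- KE2⁺: `E_Ch2` with the extra premise `Glob_inputs` — the common weakening of `E_Ch2` and
`E_Ch2Sharp`. [claim: KalethaMinguezShinWhite2014, under-review] -/
def E_Ch2Plus : Prop :=
  ∀ N, ν.IH N → ν.Ch1 N → ν.Glob N → ν.T164 → ν.MokMain → ν.TF_analytic → ν.Transfer →
    ν.EPIT_published → ν.Ar_args → ν.Glob_inputs → ν.Ch2 N

/-- Sanity: the coarse edges imply the `Plus` forms by discarding the exposed premise, and so does the
sharpened Chapter-2 edge. [claim: KalethaMinguezShinWhite2014, under-review] -/
theorem globPlus_of_coarse :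
    (ν.E_Glob → ν.E_GlobPlus) ∧ (ν.E_Ch2 → ν.E_Ch2Plus) ∧ (ν.E_Ch2Sharp → ν.E_Ch2Plus) := by
  refine ⟨?_, ?_, ?_⟩
  · intro h N hIH h1 _h2 mok tf globi epit transfer ar
    exact h N hIH h1 mok tf globi epit transfer ar
  · intro h N hIH h1 hg t164 mok tf transfer epit ar _globi
    exact h N hIH h1 hg t164 mok tf transfer epit ar
  · intro h N hIH h1 _hg t164 mok tf transfer epit ar globi
    exact h N hIH h1 t164 mok tf transfer epit ar globi

end Nodes

/-- Result-level waypoints of arXiv:1409.3731v3, Chapters 2–5 (cell LEMMAS.md §8b ids K…): one ARBITRARY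
proposition at rank `N` per result-bearing subsection, grouping its numbered results IN THE SCOPE PROVED IN
THE PAPER (starred items restricted as in the module docstring).  Nothing about their content is assumed. [claim: KalethaMinguezShinWhite2014, under-review] -/
structure Waypoints where
  -- ## Chapter 2: The local intertwining relation (F local, E/F a quadratic algebra; chap2.tex)
  /-- K22: §2.2 *Local intertwining operator I* [chap2.tex l.38-136] — Lemma 2.2.1 (F = ℝ, φ ∈ Φ_bdd(M*): R_{P′|P}(ξ,φ_λ) regular and non-zero at λ = 0, multiplicative in P; l.76), Lemma 2.2.2 (global factorisation R_{P′|P}(ξ,ψ_λ) = ⊗_v, l.87), Lemma* 2.2.3 in its proved case (F p-adic, ψ = φ ∈ Φ(M*), E/F a field; l.94-109), Lemma 2.2.5 (l.118); Lemma* 2.2.4 (general ψ) formulated only (l.111-116). -/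
  K22 : Nat → Prop
  /-- K23: §2.3 *Local intertwining operator II* [l.137-239] — the operator l_P(w,ξ,ψ,ψ_F): Lemma 2.3.1 (cocycle relation, l.160), Fact 2.3.2 (l.231). -/
  K23 : Nat → Prop
  /-- K24: §2.4 *Local intertwining operator III* [l.240-320] — the operator π(u♮)_{ξ,z}: Lemma 2.4.1 (l.296). -/
  K24 : Nat → Prop
  /-- K25: §2.5 *the compound operator* R_P(u♮,Ξ,π,ψ,ψ_F) [l.321-392] — Lemma 2.5.1 (independence of (ξ,z) ∈ Ξ, l.343), Lemma 2.5.2 (equivariance, l.369), Lemma 2.5.3 (multiplicativity in u♮, l.387). -/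
  K25 : Nat → Prop
  /-- K26: §2.6 *The local intertwining relation* [l.393-512] — the linear forms f_{G,Ξ}(ψ,u♮), f′_{G,Ξ}(ψ,s), the STATEMENT of Theorem* 2.6.2 (l.433) and Lemma 2.6.1 (l.407), Lemmas 2.6.3–2.6.5 (l.451-486), Remark 2.6.6, Cor 2.6.7 (l.496). -/
  K26 : Nat → Prop
  /-- K27: §2.7 *A preliminary result on the LIR I* [l.513-761] — Lemmas* 2.7.1, 2.7.2 for E/F a field ("The case where E/F is a split algebra … [KMS_B]" l.669), Prop 2.7.3 (parts 2, 3 of Thm 2.6.2 reduce to ψ ∈ Ψ₂(M*), l.543), Prop 2.7.4, Lemmas 2.7.5–2.7.8 (l.578-705). -/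
  K27 : Nat → Prop
  /-- K28: §2.8 *A preliminary result on the LIR II* [l.762-984] — Lemmas 2.8.1, 2.8.3, 2.8.4, 2.8.6, 2.8.7, 2.8.8, 2.8.10, Cor 2.8.9 ("Theorem 2.6.2 holds for all u♮ … mapping to x unless either ψ is elliptic and x ∈ S♮_{ψ,ell}, or ψ ∈ Ψ_EXC(G*)", l.941-949), Remarks 2.8.2, 2.8.5. -/
  K28 : Nat → Prop
  /-- K29: §2.9 *A proof of the LIR in a special case* [l.985-1196] — Prop 2.9.1 ("Theorem 2.6.2 is valid for the parabolic pair (M,P) of G and the parameter φ whenever x ∈ {−2,−1,−½,0,½,1,2}", F = ℝ, the exceptional parameters of the rank-4 case; l.1019), Lemma 2.9.2 (l.1120). -/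
  K29 : Nat → Prop
  -- ## Chapter 3: The trace formula (global; chap3.tex)
  /-- K31: §3.1 *The discrete part of the untwisted trace formula* [chap3.tex l.9-82] — I^G_{disc,t} and its decompositions, the stabilisation for inner twists of U_{E/F}(N) (no numbered items). -/
  K31 : Nat → Prop
  /-- K32: §3.2 *The vanishing of coefficients* [l.83-152] — Lemmas 3.2.1, 3.2.2 (l.104, l.116). -/
  K32 : Nat → Prop
  /-- K33: §3.3 *Stable multiplicity formula for unitary groups* [l.153-234] — Prop 3.3.1 (SMF, "= [Mok, Thm 5.1.2]", imported: "we take this for granted" l.200-205), Cor 3.3.2 (l.216), the ψ-decomposition of L²_disc and of tr R_disc (l.162-195). -/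
  K33 : Nat → Prop
  /-- K34: §3.4 *The global intertwining operator* [l.235-283] — definitions (no numbered items): π_M's parameter ψ_{M*} "given by the induction hypothesis" (l.238), the global operators. -/
  K34 : Nat → Prop
  /-- K35: §3.5 *The global intertwining relation* [l.284-621] — Lemmas 3.5.1, 3.5.2, Prop* 3.5.3 in its proved case (global pure inner twists, z_+ = 1, l.373-391: the temporary assumption "ψ_{M,+} generic" of l.378 is dropped at l.391 "Now we drop the assumption that $\psi_{M,+}$ is generic … the above argument still goes through"; general case deferred to [KMS_B], l.378), Prop 3.5.4 (l.398), Lemmas 3.5.5, 3.5.6, Theorem 3.5.7 (GIR, "Assume that the local intertwining relation holds for the pair (M*,G*) and ψ_{M*,v} for each place v", l.475-478 — a conditional statement), Remark 3.5.8, Lemmas 3.5.9–3.5.12 (l.519-573). -/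
  K35 : Nat → Prop
  /-- K36: §3.6 *The standard model* [l.622-761] — Prop 3.6.1 (endoscopic expansion of I^G_{disc,ψ}, l.638), Lemma 3.6.2 (l.656), Hypothesis 3.6.3 (the named hypothesis "the local classification theorem holds for ψ_v at every v", l.682 — a definition, not a result), Prop 3.6.4 (l.698), Cor 3.6.5 (l.731; second part "assuming Hypothesis 3.6.3"). -/
  K36 : Nat → Prop
  /-- K37: §3.7 *On global non-elliptic exceptional parameters* [l.762-792] — Lemma 3.7.1 (l.766). -/
  K37 : Nat → Prop
  /-- K38: §3.8 *On global elliptic parameters I* [l.793-867] — Lemma 3.8.1 (l.806). -/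
  K38 : Nat → Prop
  -- ## Chapter 4: Globalizations and the local classification (chap4.tex)
  /-- K41: §4.1 *Globalization of the group* [chap4.tex l.30-118] — Lemmas 4.1.1, 4.1.2, 4.1.3 (l.35, l.62, l.95). -/
  K41 : Nat → Prop
  /-- K42: §4.2 *Globalization of the representation* [l.119-178] — Lemmas 4.2.1, 4.2.2, 4.2.3 (l.123, l.148, l.170 = `lem:globalize_for_iop1`, the one Lemma* 2.2.3 applies). -/
  K42 : Nat → Prop
  /-- K43: §4.3 *Globalization of a simple parameter* [l.179-273] — Lemmas 4.3.1, 4.3.2 (l.186, l.214). -/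
  K43 : Nat → Prop
  /-- K44: §4.4 *Globalization of a parameter* [l.274-953] — Lemma 4.4.1 (l.337), Props 4.4.2–4.4.7 (l.415, 482, 531, 740, 829, 911; the case organisation of l.276-287). -/
  K44 : Nat → Prop
  /-- K45: §4.5 *On global elliptic parameters, II* [l.954-1094] — Lemma 4.5.1 (l.958). -/
  K45 : Nat → Prop
  /-- K46: §4.6 *Proof of the local intertwining relation* [l.1095-1372] — Lemmas 4.6.1–4.6.5 (l.1099, 1229, 1285, 1326, 1353): Theorem* 2.6.2 for φ_{M*} ∈ Φ_{2,bdd}(M*) (l.1313) and then φ_{M*} ∈ Φ_bdd(M*) (l.1326-1346), E/F a field (chap4.tex l.1096 VERBATIM: "The case of inner forms of linear groups, corresponding to $E=F\times F$, will be treated in \cite{KMS_B}"; the parallel sentence of §2.2 is chap2.tex l.100: "The case where $E/F$ is a split algebra and hence $G^*$ is a linear group will be treated in \cite{KMS_B}"); Lemma 4.6.5 (R_φ(M,G) ≅ R_σ(M,G)). -/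
  K46 : Nat → Prop
  /-- K47: §4.7 *Local packets for non-discrete parameters* [l.1373-1407] — Prop 4.7.1 (Theorem 1.6.1 for φ ∈ Φ_bdd(G*) ∖ Φ₂(G*), l.1403). -/
  K47 : Nat → Prop
  /-- K48: §4.8 *Elliptic orthogonality relations* [l.1408-1566] — Props 4.8.1, 4.8.2, 4.8.3 (l.1467, 1494, 1522). -/
  K48 : Nat → Prop
  /-- K49: §4.9 *Local packets for square-integrable parameters* [l.1567-1775] — Lemma 4.9.1 (l.1577), Props 4.9.2, 4.9.3, 4.9.4 (l.1653, 1677, 1721) and the closing argument (l.1753-1764): Theorem 1.6.1 for φ ∈ Φ_{2,bdd}(G*) ("This completes the proof of Theorem 1.6.1 for discrete generic parameters … Theorem 1.6.1 has now been established for all generic parameters and all pure inner twists of unitary groups" l.1764). -/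
  K49 : Nat → Prop
  -- ## Chapter 5 (chap6.tex): Proof of the main global theorem
  /-- K50: Theorem 5.0.1 [chap6.tex l.17-22] under its two assumptions (Hypothesis 3.6.3 and Theorem 2.6.2 for ψ_v at every place, l.10-14). -/
  K50 : Nat → Prop

namespace Waypoints

variable (ω : Waypoints) (ν : Nodes)

/-! ## Fine edges of §§4.1–4.3 (the globalisations; first inside rank N) -/

/-- KF41: §4.1 ⇐ the cohomological preliminaries of §0.3 (l.79, l.90; `Ch1 N`), "[Kot86, Cor 2.5, Prop 2.6]" (l.88; `EPIT_published`), "[Arthur, Lem 6.2.1]" by reference (l.48; `Ar_args`) [chap4.tex l.30-118]. [claim: KalethaMinguezShinWhite2014, under-review] -/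
def KF41 : Prop := ∀ N, ν.Ch1 N → ν.EPIT_published → ν.Ar_args → ω.K41 N

/-- KF42: §4.2 ⇐ Chapter 1 and "[Shi12]": "The result will follow from an application of Theorem 4.8 of [Shi12]" (l.133; l.137, 158, 161, 167; `Glob_inputs`) [chap4.tex l.119-178]. [claim: KalethaMinguezShinWhite2014, under-review] -/
def KF42 : Prop := ∀ N, ν.Ch1 N → ν.Glob_inputs → ω.K42 N

/-- KF43: §4.3 ⇐ Prop 1.3.3 (Mok's second seed theorem restated, l.180; `Ch1 N`, `MokMain`), Lemmas 4.2.1, 4.2.2 (l.203, 235, 238, 267, 270; K42) [chap4.tex l.179-273]. [claim: KalethaMinguezShinWhite2014, under-review] -/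
def KF43 : Prop := ∀ N, ν.Ch1 N → ν.MokMain → ω.K42 N → ω.K43 N

/-! ## Fine edges of Chapter 2 -/

/-- KF22: §2.2 ⇐ IH ("We assume the validity of Theorem 1.6.1 for M (as part of the induction hypothesis)" l.40; Lemma* 2.2.3 "Assume the validity of Theorem 1.6.1 and 1.7.1 for the proper Levi subgroups of G" l.95), the Mok imports ("The case G = G* and ξ = id is part of our assumptions listed in Section 1.5" l.102; quasi-split places l.108; `MokMain`, restated in `Ch1 N`), Lemma 4.2.3 ("we pass to a global situation by applying Lemma [4.2.3]" l.104; K42), "[ArtIOR1, §§1–3, Theorem 2.1]" and "Langlands' theory of Eisenstein series" (l.49, 80, 84, 104, 106; `TF_analytic`), "[TateCorvallis, (3.6.6)]", "[Hen10]", "[Tate67, (3.3)]" (l.72, 91; `EPIT_published`), "[Arthur, §2.3]" by reference (l.46, 68; `Ar_args`); the global operator of Lemma 2.2.2 is the one DEFINED in §3.4 ((3.4.·) at l.89, 91 — notation, not a result) [chap2.tex l.38-136]. [claim: KalethaMinguezShinWhite2014, under-review] -/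
def KF22 : Prop :=
  ∀ N, ν.IH N → ν.Ch1 N → ν.MokMain → ν.TF_analytic → ν.EPIT_published → ν.Ar_args → ω.K42 N → ω.K22 N

/-- KF23: §2.3 ⇐ §0.4 (l.141; `Ch1 N`), IH (the packet Π_ψ(M,Ξ_M) of Theorem 1.6.1 for M, l.164-198), "[LS87, §2.1, Lemma 2.1.A]" (l.149, 188; `Transfer`), "[Hen10]", "[TateCorvallis, (3.6.8)]", "[LanArt, Thm 2.1]" (l.152, 207, 222; `EPIT_published`), "[KS88, (4.1)]" (l.154, 220; `TF_analytic`), "[Arthur, Lemma 2.3.4, §2.3]" by reference (l.150, 179; `Ar_args`), §2.2 (K22) [chap2.tex l.137-239]. [claim: KalethaMinguezShinWhite2014, under-review] -/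
def KF23 : Prop :=
  ∀ N, ν.IH N → ν.Ch1 N → ν.Transfer → ν.EPIT_published → ν.TF_analytic → ν.Ar_args → ω.K22 N → ω.K23 N

/-- KF24: §2.4 (Lemma 2.4.1) ⇐ IH and Thm 1.6.4 (Theorem 1.6.1 for M = M₋ × M₊: the linear part by §1.6.2 from Thm 1.6.4, the unitary part by induction; l.268, 313; `T164`, `Ch1 N`), Prop 1.5.1 (l.294, 311; `MokMain`, `Ch1 N`), §0.4 Lemmas 0.4.16, 0.4.17, §§1.1, 1.6 (l.266, 283, 308, 317; `Ch1 N`), "[KS99, §2.2]" (l.292; `Transfer`), "[Arthur, §2.2]" by reference (l.251; `Ar_args`), §§2.2–2.3 (K22, K23) [chap2.tex l.240-320]. [claim: KalethaMinguezShinWhite2014, under-review] -/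
def KF24 : Prop :=
  ∀ N, ν.IH N → ν.Ch1 N → ν.T164 → ν.MokMain → ν.Transfer → ν.EPIT_published → ν.Ar_args → ω.K22 N →
    ω.K23 N → ω.K24 N

/-- KF25: §2.5 ⇐ Lemma 0.4.18, Lemma 1.1.2, (0.3.·) (l.335, 367, 377-381; `Ch1 N`), Lemma 2.4.1 (l.357, 377, 383; K24), "Lemmas [2.2.4], [2.2.5], [2.3.1], and Fact [2.3.2]" (Lemma 2.5.3, l.390; in the proved scope Lemma* 2.2.4 is Lemma 2.2.1 / Lemma* 2.2.3; K22, K23) [chap2.tex l.321-392]. [claim: KalethaMinguezShinWhite2014, under-review] -/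
def KF25 : Prop := ∀ N, ν.Ch1 N → ω.K22 N → ω.K23 N → ω.K24 N → ω.K25 N

/-- KF26: §2.6 ⇐ IH (Theorem 1.6.1 for M: packets and pairings in the statement of Thm* 2.6.2, l.399, 403; Remark 2.6.6), Lemmas 1.1.2, 1.1.4, 0.4.11, 0.4.13, 0.4.15, 0.4.18, §1.4 (l.403-426, 501; `Ch1 N`), "[Arthur, (4.5.8), Prop 2.1.1]" by reference (l.415, 423; `Ar_args`), Lemma 2.5.3 and Lemma 2.5.2 (l.443, 478-493; K25), Lemma 2.3.1, Fact 2.3.2 (l.462-464; K23), Lemma 2.2.5 (l.464-466; K22), Lemma 2.4.1 (l.468; K24) [chap2.tex l.393-512].  v1.1 PREMISE AUDIT (cell GAPS G-UP-73): the DEFINITION of the second linear form f′_{G,Ξ}(ψ,s) invokes, in prose, the quasi-split import and the transfer of functions — "From $\psi^{\fke}$ we obtain the stable linear form on $\mc{H}(G^\mf{e})$ in part 4 of Theorem \ref{thm:locclass-single}" (l.403; G^𝔢 is a quasi-split unitary group or a product of two, so this is Theorem* 1.6.1 part 4 in the case "part of our assumptions listed in Section 1.5" = [Mok, Thm 3.2.1(a)];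 `MokMain`, as `KF22`/`KF24`/`KF27` type it) and "The value of this stable linear form on all functions $f^\mf{e} \in \mc{H}(G^\mf{e})$ whose orbital integrals match those of $f$ with respect to the transfer factor $\Delta[\mf{e},\Xi]$ is the same" (l.405), "from the fact that $f^\fke_{M^\fke_s}$ is a transfer of $f$" (l.423), "$f^\fke_{M^\fke_s}$ is a transfer of $f_{M_s}$" (l.425) (`Transfer`); hence `MokMain`, `Transfer` ADDED (no `\cite` carries them in §2.6, which is why v1.0's mechanical census missed them). [claim: KalethaMinguezShinWhite2014, under-review] -/
def KF26 : Prop :=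
  ∀ N, ν.IH N → ν.Ch1 N → ν.MokMain → ν.Transfer → ν.Ar_args → ω.K22 N → ω.K23 N → ω.K24 N → ω.K25 N →
    ω.K26 N

/-- KF27: §2.7 ⇐ IH and Prop 1.5.1 (Theorem 1.6.1 for M, l.738; `Ch1 N`), the Mok imports of §1.5 (twisted intertwining relation for G̃(N), l.585, 669; `MokMain`), Prop 1.1.5, Lemma 1.1.7, §§0.2, 1.1 (l.555, 585, 655, 662; `Ch1 N`), "[LS87, Lemma 2.1.A]" (l.613, 709; `Transfer`), "[Arthur, (2.3.25)]" by reference (l.595; `Ar_args`), Lemma 2.3.1 (l.608-683; K23), Lemma 2.5.3 (l.683; K25), Lemma* 2.2.4 in its proved scope (l.683; K22), §2.6 (l.575; K26) [chap2.tex l.513-761].  v1.1 PREMISE AUDIT (cell GAPS G-UP-73): the proof of Lemma* 2.7.1 uses the §2.4 construction — "As discussed in the beginning of Section \ref{sec:iop3b}, there exists a canonical choice for the isomorphism $(V_{\pi_k},\pi_k\circ(\tilde w_k\tilde w_{k-1}\dots \tilde w_1\theta)^{-1}) \rw (V_{\pi_k},\pi_k)$ and we require that our choices of $\iota_1,\dots,\iota_k$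 are such that the composition $\iota_k\dots\iota_1$ is equal to this canonical isomorphism" (l.567; `sec:iop3b` = §2.4, whose opening l.251-255 fixes the Whittaker-normalised isomorphism π∘θ⁻¹ → π "recall[ing] a discussion from \cite[\S2.2]{Arthur}") — covered in v1.0 only through `Ar_args`; the fine-level faithful form ADDS the waypoint `K24` (order-consistent: K24 precedes K27). [claim: KalethaMinguezShinWhite2014, under-review] -/
def KF27 : Prop :=
  ∀ N, ν.IH N → ν.Ch1 N → ν.MokMain → ν.Transfer → ν.Ar_args → ω.K22 N → ω.K23 N → ω.K24 N → ω.K25 N →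
    ω.K26 N → ω.K27 N

/-- KF28: §2.8 ⇐ IH (Theorem 2.6.2 and the local theorems in lower rank, l.876-952), "[Arthur, (6.4.1), (4.1.7), p.331, Prop 4.5.1]" by reference (l.772, 821, 823, 843, 868; `Ar_args`), "[Mok, (7.4.1)]" (l.772; `MokMain`), "[KotSign, Cor (6)]" (l.927; `EPIT_published`), (2.1.·) (l.968; `Ch1 N`), Lemma 2.5.3 (l.885; K25), Lemma 2.6.1 (l.885-967; K26), Lemma* 2.7.2 and Prop 2.7.3 (l.801, 885, 921; K27) [chap2.tex l.762-984]. [claim: KalethaMinguezShinWhite2014, under-review] -/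
def KF28 : Prop :=
  ∀ N, ν.IH N → ν.Ch1 N → ν.MokMain → ν.EPIT_published → ν.Ar_args → ω.K25 N → ω.K26 N → ω.K27 N → ω.K28 N

/-- KF29: §2.9 (Prop 2.9.1, F = ℝ) ⇐ published archimedean inputs — "[GGP12, Thm 8.1, §4]" (l.1001, 1003), "[Kal13, §5.6]" (l.1039, 1055), Theorem 1.6.1 over ℝ (l.1037, 1050; Langlands–Shelstad, cf. chap4.tex l.1375) (`EPIT_published`), "the endoscopic character identities for real groups [She82], [SheTE2], [SheTE3]" (l.1039), "[LanRice]" (l.1076) (`Transfer`), "known for real groups [KZ79, §3]" (l.1035; `TF_analytic`) — and the Chapter-2 formalism over ℝ: §2.4, (2.4.·) (l.1037-1063; K24), Lemma 2.5.3, (2.5.·) (l.1035-1045; K25), (2.6.·) (l.1035-1043; K26) [chap2.tex l.985-1196].  v1.1 PREMISE AUDIT (cell GAPS G-UP-73): the proof of Prop 2.9.1 runs on the §2.1 diagram and the Chapter-0/1 formalism — "We begin by making explicit Diagram \eqref{eq:diag}" (l.1023; the diagram (2.1.·) of §2.1, which this module files under `Ch1 N`, cf. `KF28`), the groups S_φ(M),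 S_φ^rad, pure inner twists (ξ,z) and Kottwitz pairings of §§0.3–0.4 — so `Ch1` is ADDED (every other Chapter-2 edge carries it); the two invocations of "Theorem \ref{thm:locclass-single}" for the proper Levi subgroup M over ℝ (l.1037, l.1050) stay read as the published archimedean case (`EPIT_published`/`Transfer`, cell LEMMAS §8b.4 (d); the alternative reading `IH N` would be free and status-neutral); the pointer to §2.8 at l.1017 ("(exc1) and (exc2) where [sic] the exceptional parameter types discussed in Section \ref{sub:prelim-local-intertwining}") is definitional, no result of §2.8 is used (the proof l.1023-1196 cites no §2.8 item). [claim: KalethaMinguezShinWhite2014, under-review] -/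
def KF29 : Prop :=
  ∀ N, ν.Ch1 N → ν.Transfer → ν.EPIT_published → ν.TF_analytic → ω.K24 N → ω.K25 N → ω.K26 N → ω.K29 N

/-- KR2: the Chapter-2 waypoints together give the coarse output `Ch2 N` (companion docstring of `Nodes.Ch2`). [claim: KalethaMinguezShinWhite2014, under-review] -/
def KR2 : Prop :=
  ∀ N, ω.K22 N → ω.K23 N → ω.K24 N → ω.K25 N → ω.K26 N → ω.K27 N → ω.K28 N → ω.K29 N → ν.Ch2 N

/-! ## Fine edge of §4.4 and the reading of `Glob N` -/

/-- KF44: §4.4 ⇐ Lemmas 4.1.1–4.1.3 (l.365, 456, 516, 949; K41), Lemmas 4.3.1, 4.3.2 (l.375, 590, 591; K43), Props 1.3.1, 1.3.3 (Mok's seed theorems restated), Lemma 1.2.5, §§1.2–1.3 (l.387-408; `Ch1 N`, `MokMain`; "[Mok, Lem 7.2.2]" l.290 is a footnote "we do not need such a result"), "[Arthur, Prop 6.3.1]" by reference (l.407-414; `Ar_args`), "[Kot86, Prop 2.6]" (l.523; `EPIT_published`), and Prop 2.9.1 (Prop 4.4.6: l.827, 887-899; through `Ch2 N` — see the module docstring)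 [chap4.tex l.274-953]. [claim: KalethaMinguezShinWhite2014, under-review] -/
def KF44 : Prop :=
  ∀ N, ν.Ch1 N → ν.Ch2 N → ν.MokMain → ν.EPIT_published → ν.Ar_args → ω.K41 N → ω.K43 N → ω.K44 N

/-- KRGlob: the §§4.1–4.4 waypoints together give the coarse output `Glob N` (companion docstring of `Nodes.Glob`). [claim: KalethaMinguezShinWhite2014, under-review] -/
def KRGlob : Prop := ∀ N, ω.K41 N → ω.K42 N → ω.K43 N → ω.K44 N → ν.Glob N

/-! ## Fine edges of Chapter 3 -/

/-- KF31: §3.1 ⇐ the stabilisation of I^G_{disc,t} for inner twists ("established by Arthur ([ArtSTF1], [ArtSTF2], [ArtSTF3]) … fundamental lemmas … Ngô, Waldspurger and Chaudouard-Laumon", l.33; `StabOrdI` via `E_StabOrdI`; "[LN08]" l.33, `FL`), "[Mul89]" (convergence, l.28; `TF_analytic`), "[KS99, p.29]", "[Lan79]", "[Wal97]" (l.36, 38, 46; `Transfer`), "[Arthur, (3.2.4), 3.2]" by reference (l.11, 41, 45, 67, 71; `Ar_args`), Chapter 1 (`Ch1 N`) [chap3.tex l.9-82]. [claim: KalethaMinguezShinWhite2014,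 under-review] -/
def KF31 : Prop :=
  ∀ N, ν.Ch1 N → ν.StabOrdI → ν.TF_analytic → ν.Transfer → ν.FL → ν.Ar_args → ω.K31 N

/-- KF32: §3.2 ⇐ §3.1 (l.85, 102, 145; K31), "[ArtLCR, §4, §6]" (l.125, 135; `TF_analytic`), "[Arthur, (3.5.6) …]" by reference (8×, l.85-145; `Ar_args`) [chap3.tex l.83-152]. [claim: KalethaMinguezShinWhite2014, under-review] -/
def KF32 : Prop := ∀ N, ν.TF_analytic → ν.Ar_args → ω.K31 N → ω.K32 N

/-- KF33: §3.3 ⇐ Prop 3.3.1 = "[Mok, Thm 5.1.2]" ("we take this for granted" l.200-205; `MokMain`), Prop 1.5.1 (l.182; `Ch1 N`), "[ArtUAR2, §8]" (l.186, 191; `TF_analytic`), "[Arthur, (4.1.5), Prop 4.1.1, 3.2, Cor 3.4.3]" by reference (l.186-227; Cor 3.3.2 "exactly as in the proof of [Arthur, Cor 3.4.3]" from the stabilisation, the SMF and the inductive hypotheses, l.227; `Ar_args`, IH), (3.1.·) (l.162-227; K31) [chap3.tex l.153-234]. [claim: KalethaMinguezShinWhite2014, under-review] -/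
def KF33 : Prop := ∀ N, ν.IH N → ν.Ch1 N → ν.MokMain → ν.TF_analytic → ν.Ar_args → ω.K31 N → ω.K33 N

/-- KF34: §3.4 ⇐ IH ("the corresponding global parameter given by the induction hypothesis" l.238 — for M = M₋ × M₊ the linear factors by the global classification of inner forms of GL, `GL_inner`), Chapter 1 (`Ch1 N`), Langlands' theory of Eisenstein series (`TF_analytic`) [chap3.tex l.235-283]. [claim: KalethaMinguezShinWhite2014, under-review] -/
def KF34 : Prop := ∀ N, ν.IH N → ν.Ch1 N → ν.GL_inner → ν.TF_analytic → ω.K34 N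

/-- KF35: §3.5 ⇐ IH (local packets and pairings of π_{M,v}, l.373-395), Prop 1.3.3 (second seed theorem, l.289) and "[Mok]" (l.504) (`MokMain`, `Ch1 N`), §§1.3, 1.4, 1.7, Prop 1.1.3, Lemma 1.3.4, Lemmas 0.4.6, 0.4.13, 0.4.19, (0.3.·) (l.292-487; `Ch1 N`), the Chapter-2 lemmas 2.2.2, 2.5.2, 2.6.1, 2.6.3, 2.6.4, 2.6.5, 2.8.3, 2.8.4, 2.8.6, 2.8.7, 2.8.8, 2.8.10, Cor 2.8.9 (l.360-573; `Ch2 N`), "[Arthur, (4.2.3), §4.5]" by reference (l.318, 504, 542; `Ar_args`), (3.1.·), (3.3.·) (l.289; K31, K33), §3.4 (l.365-375; K34); the general case of Prop* 3.5.3 is deferred to [KMS_B] (l.378) and is not an input [chap3.tex l.284-621].  v1.1 PREMISE AUDIT (cell GAPS G-UP-74): the proof of Prop* 3.5.3's proved case invokes, in prose, the global theory of general linear groups — "$\psi_{M,+}$ … is a generic parameter so that $\pi_{M,+}$ admits a nonzero global Whittaker functional" (l.378), "$\bigotimes_v \pi_{M,v,+}(\breve w)_{\xi_v}$ is the unique intertwining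 operator $\breve w\pi_{M,+} \rw \pi_{M,+}$ that preserves a global Whittaker functional" (l.381), "$\pi_{M_+}$ is a discrete automorphic representation of $M^*_+(\A_F)$ so appears as an irreducible quotient of an induced representation from a cuspidal automorphic representation on a Levi subgroup of $M^*_+$" (l.391; the residual spectrum of GL, Mœglin–Waldspurger 1989) — the leaf `GL_inner` (companion KL02: "global: Mœglin–Waldspurger 1989 …"), ADDED; and the global transfer factor — "the fact that the adelic Kottwitz-Shelstad transfer factor depends only on the isomorphism class" (l.454), "the adelic transfer factor is independent of the choice of $\Xi$" (l.465) — `Transfer`, ADDED (the global transfer f ↦ f^𝔢 = ∏_v f^𝔢_v of (3.5.·) l.452 itself is set up in §3.1, K31).  The strategy remarks l.289 ("to be proved later in Section \ref{chapter4}") and l.577 ("cf. \S\ref{sub:elliptic-parameters} and \S\ref{subsection_elliptic_parameters_2} below") are roadmap sentences, not inputs. [claim: KalethaMinguezShinWhite2014, under-review] -/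
def KF35 : Prop :=
  ∀ N, ν.IH N → ν.Ch1 N → ν.Ch2 N → ν.MokMain → ν.GL_inner → ν.Transfer → ν.Ar_args → ω.K31 N → ω.K33 N →
    ω.K34 N → ω.K35 N

/-- KF36: §3.6 ⇐ IH ("Theorem 1.7.1 for M, available as part of the induction hypothesis", Lemma 3.6.2, l.664), Prop 3.3.1 and the sign lemmas of §1.5 (l.645-646, 715; `MokMain`; "[Mok, (5.5.16)]" l.688), Lemma 0.4.15 (l.664; `Ch1 N`), "[LS87]", "[KS12]" (l.646; `Transfer`), "[Arthur, Cor 4.4.3, Cor 4.2.4, pp.180-181, (4.3.7), Cor 4.3.3, p.187, (4.3.2)]" by reference (l.645-715; `Ar_args`), Lemmas 2.6.3, 2.6.5 (l.687, 711; `Ch2 N`), (3.1.·), (3.3.·), §3.3 (l.626-739; K31, K33), Prop 3.5.4, Lemmas 3.5.5, 3.5.6, (3.5.·), §3.5 (l.633-687; K35) [chap3.tex l.622-761]. [claim: KalethaMinguezShinWhite2014, under-review] -/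
def KF36 : Prop :=
  ∀ N, ν.IH N → ν.Ch1 N → ν.Ch2 N → ν.MokMain → ν.Transfer → ν.Ar_args → ω.K31 N → ω.K33 N → ω.K35 N →
    ω.K36 N

/-- KF37: §3.7 (Lemma 3.7.1) ⇐ Lemma 3.5.12, (3.5.·) (l.764, 783; K35), Cor 3.6.5, Lemma 3.6.2, (3.6.·) (l.775, 783, 785; K36), Lemma 2.6.1 (l.779; `Ch2 N`), Lemma 0.4.6 (l.779; `Ch1 N`), "[Arthur, Cor 4.5.2, p.210]" by reference (l.773, 780; `Ar_args`) [chap3.tex l.762-792].  v1.1 PREMISE AUDIT (cell GAPS G-UP-74): the borrowed step "Arguing as at the top of \cite[p.210]{Arthur}, we obtain $$|\ol{\cS}_\psi|^{-1}\sum_{x\in \ol{\cS}_\psi}\epsilon^{G^*}_\psi(x)f'_{G}(\psi,s_\psi x^{-1}) = \sum_{\pi_M\in \Pi_{\psi_{M^*}}}  m_{\psi_{M^*}} (\pi_M) \tr (\cI_P(\pi_M,f)).$$" (l.780-782, line breaks suppressed) consumes the multiplicities m_{ψ_{M*}}(π_M), i.e. "the multiplicity of $\pi_M$ in $L^2_{\disc,\psi_{M^*}}(M(F)\bs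 M(\A_F))$" governed by "Theorem \ref{thm:main-global} for $M$, available as part of the induction hypothesis" (Lemma 3.6.2, l.664) — the induction hypothesis for M enters §3.7 directly through the borrowed argument, exactly as `KF33` types Cor 3.3.2's "[Arthur, Cor 3.4.3]" step; `IH` ADDED (free under strong induction; status-neutral). [claim: KalethaMinguezShinWhite2014, under-review] -/
def KF37 : Prop := ∀ N, ν.IH N → ν.Ch1 N → ν.Ch2 N → ν.Ar_args → ω.K35 N → ω.K36 N → ω.K37 N

/-- KF38: §3.8 (Lemma 3.8.1) ⇐ §3.7 (l.797; K37), Cor 3.6.5 (l.813; K36), "[Arthur, (5.2.4)]" by reference (l.799, 813; `Ar_args`), "[Mok, (6.2.1)]" (l.799; `MokMain`) [chap3.tex l.793-867]. [claim: KalethaMinguezShinWhite2014, under-review] -/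
def KF38 : Prop := ∀ N, ν.MokMain → ν.Ar_args → ω.K36 N → ω.K37 N → ω.K38 N

/-- KR3: the Chapter-3 waypoints together give the coarse output `Ch3 N` (companion docstring of `Nodes.Ch3`). [claim: KalethaMinguezShinWhite2014, under-review] -/
def KR3 : Prop :=
  ∀ N, ω.K31 N → ω.K32 N → ω.K33 N → ω.K34 N → ω.K35 N → ω.K36 N → ω.K37 N → ω.K38 N → ν.Ch3 N

/-! ## Fine edges of §§4.5–4.6 (the local intertwining relation) -/

/-- KF45: §4.5 (Lemma 4.5.1) ⇐ Lemma 4.1.2 (l.986; through `Glob N`), §3.8, §3.2, Lemma 3.2.2, (3.5.·) (l.1009, 1041, 1069, 1082; `Ch3 N`), the Mok imports at the quasi-split auxiliary place (l.1005; `MokMain`), "[Arthur, Lem 5.4.3]" by reference (l.957, 1029; `Ar_args`) [chap4.tex l.954-1094].  v1.1 PREMISE AUDIT (cell GAPS G-UP-75): the borrowed step "As in the proof of \cite[Lem 5.4.3]{Arthur}, the local intertwining relation and the local classification theorem for the quasi-split group  $\dot{G}_{v_1}$ imply that there are natural isomorphisms from the $R$-group $R_{\dot{\phi}_{v_1}}$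 onto the representation theoretic $R$-groups $R(\pi_{v_1})$ for each $\pi_{v_1}$" (l.1029-1033, line breaks suppressed) runs on the theory of representation-theoretic R-groups (Harish-Chandra, Silberger, [ArtIOR1]) — `TF_analytic` (companion KL08), ADDED for uniformity with `KF32`/`KF46` (conservative; the coarse `E_Ch4lir` carries it). [claim: KalethaMinguezShinWhite2014, under-review] -/
def KF45 : Prop := ∀ N, ν.Ch3 N → ν.Glob N → ν.MokMain → ν.TF_analytic → ν.Ar_args → ω.K45 N

/-- KF46: §4.6 ⇐ IH ("via the induction hypothesis, we know the local intertwining relation for the non elliptic non exceptional relevant parameter" l.1204; l.1237-1259; "it follows from the form of M and the induction hypothesis" l.1316), Props 4.4.2, 4.4.4, 4.4.5, 4.4.6, 4.4.7 (l.1115, 1204-1214, 1301; through `Glob N`), Lemma 4.5.1 (l.1123; K45), Lemma 3.7.1, Lemma 3.5.10 (l.1124, 1301; `Ch3 N`), Prop 2.9.1 (l.1207), §§2.6–2.8: Lemmas 2.5.2, 2.6.4, 2.6.5, 2.8.4, 2.8.6, 2.8.7, Prop 2.7.3, Lemma* 2.7.1 (l.1234-1343; `Ch2 N`), the Mok imports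 at quasi-split places ("which we take on faith" l.1301; §1.5; `MokMain`, `Ch1 N`), "[Arthur]" by reference (l.1347; `Ar_args`); E/F a field (l.1096) [chap4.tex l.1095-1372].  v1.1 PREMISE AUDIT (cell GAPS G-UP-75): the proof of Lemma 4.6.4 (part 1 of Theorem* 2.6.2 for φ_{M*} ∈ Φ_bdd(M*)) uses the commuting-algebra theory of representation-theoretic R-groups — "This homomorphism is well-defined according to \ref{lem_lir_triv_R} and tells us that the representation-theoretic $R$-group $R_{\pi_{M_0}}(M_0,G)$ is abelian. As a result, the representation $\mc{I}_{P_0}(\pi_{M_0})$ decomposes as a direct sum of irreducible representations of $G(F)$, each occurring with multiplicity 1" (l.1339; Harish-Chandra / Silberger / [ArtIOR1]) — `TF_analytic` (companion KL08), ADDED (no `\cite` carries it in §4.6; the coarse `E_Ch4lir` has it). [claim: KalethaMinguezShinWhite2014, under-review] -/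
def KF46 : Prop :=
  ∀ N, ν.IH N → ν.Ch1 N → ν.Ch2 N → ν.Ch3 N → ν.Glob N → ν.MokMain → ν.TF_analytic → ν.Ar_args → ω.K45 N →
    ω.K46 N

/-- KRLIR: the §§4.5–4.6 waypoints give the coarse output `LIRg N` = Theorem* 2.6.2 for bounded parameters, E/F a field ("We have now completed the proof of Theorem 2.6.2 for all parameters φ_{M*} ∈ Φ_{2,bdd}(M*) … the more general case φ_{M*} ∈ Φ_bdd(M*)", l.1313-1346; companion docstring of `Nodes.LIRg`). [claim: KalethaMinguezShinWhite2014, under-review] -/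
def KRLIR : Prop := ∀ N, ω.K45 N → ω.K46 N → ν.LIRg N

/-! ## Fine edges of §§4.7–4.9 (the local classification for generic parameters) -/

/-- KF47: §4.7 (Prop 4.7.1) ⇐ Theorem* 2.6.2 at rank N ("Having proved the local intertwining relation in Section 4.6 we can now complete the proof" l.1375; l.1378, 1398; `LIRg N`), IH (Theorem 1.6.1 for M, l.1380), §§2.4–2.6, Lemma 2.5.2 (l.1378-1402; `Ch2 N`), Lemma 4.6.5 (l.1396; K46), "the archimedean case is already known by the work of Langlands [Lan89], and Shelstad [She82], [SheTE2], [SheTE3]" (l.1375; `Transfer`), "[Kal13, §5.6]" (l.1375; `EPIT_published`), "[ArtETC, §1, Prop 1.1]" (l.1382, 1388; `TF_analytic`), "[Arthur, p.154]" by reference (l.1382; `Ar_args`), Chapter 1 (`Ch1 N`) [chap4.tex l.1373-1407]. [claim: KalethaMinguezShinWhite2014, under-review] -/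
def KF47 : Prop :=
  ∀ N, ν.IH N → ν.Ch1 N → ν.Ch2 N → ν.LIRg N → ν.TF_analytic → ν.Transfer → ν.EPIT_published → ν.Ar_args →
    ω.K46 N → ω.K47 N

/-- KF48: §4.8 ⇐ "[ArtETC]" (elliptic tempered characters, trace Paley–Wiener: l.1410-1418, 1430, "[ArtETC, Cor. 3.2]" l.1506) and "[ArtLCR, §1, Prop 3.5]" (l.1502, 1514) (`TF_analytic`; the stabilised elliptic inner product uses transfer, `Transfer`), "[Arthur, Cor 6.5.2, Prop 6.5.1, (6.5.6), (6.5.8), (6.5.12)]" by reference (l.1502-1516; `Ar_args`), "(6.5.12) applies to quasi-split G^𝔢 … part of our assumptions in §1.5" (l.1516; `MokMain`), §1.4 (l.1450; `Ch1 N`), §2.5, Lemma 2.5.2 (l.1410-1428, 1506; `Ch2 N`), Lemma 4.6.5 (l.1420, 1549; K46), Theorem* 2.6.2 "which we have now proved" (l.1422; `LIRg N`), IH (Theorem 1.6.1 for M: "the character ⟨σ,−⟩_{Ξ_M} … associated to the representation σ by Theorem 1.6.1" l.1426) [chap4.tex l.1408-1566]. [claim: KalethaMinguezShinWhite2014, under-review]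 -/
def KF48 : Prop :=
  ∀ N, ν.IH N → ν.Ch1 N → ν.Ch2 N → ν.LIRg N → ν.MokMain → ν.TF_analytic → ν.Transfer → ν.Ar_args →
    ω.K46 N → ω.K48 N

/-- KF49: §4.9 ⇐ IH ("by the induction hypothesis applied to Ṁ" l.1587), Prop 1.6.2 (reduction to pure inner twists; N odd "follows by assumption from the quasi-split case" l.1570-1572), Lemma 1.3.2, §1.5 ("our list of assumptions", places v ∉ {u, v₂}, l.1611) (`Ch1 N`, `MokMain`), Prop 4.4.3 (l.1574) and Lemma 4.2.1 (l.1756) (through `Glob N`), (3.3.·), Prop 3.6.1, Cor 3.3.2, Prop 3.3.1 (l.1590, 1594, 1756; `Ch3 N`), Prop 4.8.3, (4.8.·) (l.1615, 1698, 1699; K48), the archimedean place v₂: Shelstad and "[Kal13, §5.6]" (l.1611-1613; `Transfer`, `EPIT_published`), cuspidal functions / trace Paley–Wiener (`TF_analytic`), "[Arthur, Cor 6.7.4]" by reference (l.1747; `Ar_args`) [chap4.tex l.1567-1775]. [claim: KalethaMinguezShinWhite2014, under-review] -/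
def KF49 : Prop :=
  ∀ N, ν.IH N → ν.Ch1 N → ν.Ch3 N → ν.Glob N → ν.MokMain → ν.TF_analytic → ν.Transfer → ν.EPIT_published →
    ν.Ar_args → ω.K48 N → ω.K49 N

/-- KRLoc: Prop 4.7.1, §4.8 and §4.9 together with Chapter 1 (§1.6.2: the case E = F × F from Thm 1.6.4; Prop 1.6.2) give the coarse output `T161g N` = Theorem* 1.6.1 for generic parameters ("Theorem 1.6.1 has now been established for all generic parameters and all pure inner twists of unitary groups" l.1764; companion docstring of `Nodes.T161g`). [claim: KalethaMinguezShinWhite2014, under-review] -/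
def KRLoc : Prop := ∀ N, ν.Ch1 N → ω.K47 N → ω.K48 N → ω.K49 N → ν.T161g N

/-! ## Fine edge of Chapter 5 (chap6.tex) -/

/-- KF50: Theorem 5.0.1 ⇐ §3.3 (the ψ-decomposition, l.8), Cor 3.6.5 (l.26, 31), Theorem 3.5.7 (l.26), (3.6.·) (⁰r^G_{disc,ψ}, l.31) (`Ch3 N`), and its two assumptions (l.10-14) discharged in the proved scope: "These have been established if ψ = φ is generic and if (G,ξ) is realized as a pure inner twist of G*. (The latter condition implies that G_v is a split group at every place v of F split in E …)" (l.15) — Theorem* 1.6.1 for generic parameters (`T161g N`), Theorem* 2.6.2 for bounded parameters (`LIRg N`) at the non-split places, the Mok imports and Thm 1.2.4 / Cor 1.6.3 / Thm 1.6.4 at the quasi-split and split places (`MokMain`, `Ch1 N`, `T164`) [chap6.tex l.3-37]. [claim: KalethaMinguezShinWhite2014, under-review] -/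
def KF50 : Prop := ∀ N, ν.Ch1 N → ν.Ch3 N → ν.T161g N → ν.LIRg N → ν.MokMain → ν.T164 → ω.K50 N

/-- KR5: Theorem 5.0.1 in the proved scope is the coarse output `T171p N` (companion docstring of `Nodes.T171p`). [claim: KalethaMinguezShinWhite2014, under-review] -/
def KR5 : Prop := ∀ N, ω.K50 N → ν.T171p N

/-- The fine edges, bundled. [claim: KalethaMinguezShinWhite2014, under-review] -/
structure FineEdges : Prop where
  kf41 : ω.KF41 ν
  kf42 : ω.KF42 ν
  kf43 : ω.KF43 ν
  kf22 : ω.KF22 ν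
  kf23 : ω.KF23 ν
  kf24 : ω.KF24 ν
  kf25 : ω.KF25 ν
  kf26 : ω.KF26 ν
  kf27 : ω.KF27 ν
  kf28 : ω.KF28 ν
  kf29 : ω.KF29 ν
  kf44 : ω.KF44 ν
  kf31 : ω.KF31 ν
  kf32 : ω.KF32 ν
  kf33 : ω.KF33 ν
  kf34 : ω.KF34 ν
  kf35 : ω.KF35 ν
  kf36 : ω.KF36 ν
  kf37 : ω.KF37 ν
  kf38 : ω.KF38 ν
  kf45 : ω.KF45 ν
  kf46 : ω.KF46 ν
  kf47 : ω.KF47 ν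
  kf48 : ω.KF48 ν
  kf49 : ω.KF49 ν
  kf50 : ω.KF50 ν

/-- The readings "waypoints of a block ⟹ its coarse output node", bundled. [claim: KalethaMinguezShinWhite2014, under-review] -/
structure Readings : Prop where
  kr2 : ω.KR2 ν
  krGlob : ω.KRGlob ν
  kr3 : ω.KR3 ν
  krLIR : ω.KRLIR ν
  krLoc : ω.KRLoc ν
  kr5 : ω.KR5 ν

/-! ## Kernel-checked bookkeeping -/

/-- The Chapter-2 fine edges (with KF42 for Lemma 4.2.3) compose to `Nodes.E_Ch2Sharp`. [claim: KalethaMinguezShinWhite2014, under-review] -/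
theorem ch2_of_fine (E : ω.FineEdges ν) (R : ω.Readings ν) : ν.E_Ch2Sharp := by
  intro N hIH h1 t164 mok tf transfer epit ar globi
  have k42 : ω.K42 N := E.kf42 N h1 globi
  have k22 : ω.K22 N := E.kf22 N hIH h1 mok tf epit ar k42
  have k23 : ω.K23 N := E.kf23 N hIH h1 transfer epit tf ar k22
  have k24 : ω.K24 N := E.kf24 N hIH h1 t164 mok transfer epit ar k22 k23
  have k25 : ω.K25 N := E.kf25 N h1 k22 k23 k24
  have k26 : ω.K26 N := E.kf26 N hIH h1 mok transfer ar k22 k23 k24 k25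
  have k27 : ω.K27 N := E.kf27 N hIH h1 mok transfer ar k22 k23 k24 k25 k26
  have k28 : ω.K28 N := E.kf28 N hIH h1 mok epit ar k25 k26 k27
  have k29 : ω.K29 N := E.kf29 N h1 transfer epit tf k24 k25 k26
  exact R.kr2 N k22 k23 k24 k25 k26 k27 k28 k29

/-- The §§4.1–4.4 fine edges compose to `Nodes.E_GlobPlus`. [claim: KalethaMinguezShinWhite2014, under-review] -/
theorem glob_of_fine (E : ω.FineEdges ν) (R : ω.Readings ν) : ν.E_GlobPlus := by
  intro N _hIH h1 h2 mok _tf globi epit _transfer ar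
  have k41 : ω.K41 N := E.kf41 N h1 epit ar
  have k42 : ω.K42 N := E.kf42 N h1 globi
  have k43 : ω.K43 N := E.kf43 N h1 mok k42
  have k44 : ω.K44 N := E.kf44 N h1 h2 mok epit ar k41 k43
  exact R.krGlob N k41 k42 k43 k44

/-- The Chapter-3 fine edges compose to the coarse edge `Nodes.E_Ch3` with the SAME premises. [claim: KalethaMinguezShinWhite2014, under-review] -/
theorem ch3_of_fine (E : ω.FineEdges ν) (R : ω.Readings ν) : ν.E_Ch3 := by
  intro N hIH h1 h2 mok stabOrd tf gl transfer fl _epit ar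
  have k31 : ω.K31 N := E.kf31 N h1 stabOrd tf transfer fl ar
  have k32 : ω.K32 N := E.kf32 N tf ar k31
  have k33 : ω.K33 N := E.kf33 N hIH h1 mok tf ar k31
  have k34 : ω.K34 N := E.kf34 N hIH h1 gl tf
  have k35 : ω.K35 N := E.kf35 N hIH h1 h2 mok gl transfer ar k31 k33 k34
  have k36 : ω.K36 N := E.kf36 N hIH h1 h2 mok transfer ar k31 k33 k35
  have k37 : ω.K37 N := E.kf37 N hIH h1 h2 ar k35 k36
  have k38 : ω.K38 N := E.kf38 N mok ar k36 k37
  exact R.kr3 N k31 k32 k33 k34 k35 k36 k37 k38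

/-- The §§4.5–4.6 fine edges compose to the coarse edge `Nodes.E_Ch4lir` with the SAME premises. [claim: KalethaMinguezShinWhite2014, under-review] -/
theorem lir_of_fine (E : ω.FineEdges ν) (R : ω.Readings ν) : ν.E_Ch4lir := by
  intro N hIH h1 h2 h3 hg mok tf _transfer _epit ar
  have k45 : ω.K45 N := E.kf45 N h3 hg mok tf ar
  have k46 : ω.K46 N := E.kf46 N hIH h1 h2 h3 hg mok tf ar k45
  exact R.krLIR N k45 k46

/-- The §§4.5–4.9 fine edges compose to the coarse edge `Nodes.E_Ch4loc` with the SAME premises (§§4.5–4.6 re-derived inside, for Lemma 4.6.5). [claim: KalethaMinguezShinWhite2014, under-review] -/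
theorem loc_of_fine (E : ω.FineEdges ν) (R : ω.Readings ν) : ν.E_Ch4loc := by
  intro N hIH h1 h2 h3 hg hlir mok tf transfer epit ar
  have k45 : ω.K45 N := E.kf45 N h3 hg mok tf ar
  have k46 : ω.K46 N := E.kf46 N hIH h1 h2 h3 hg mok tf ar k45
  have k47 : ω.K47 N := E.kf47 N hIH h1 h2 hlir tf transfer epit ar k46
  have k48 : ω.K48 N := E.kf48 N hIH h1 h2 hlir mok tf transfer ar k46
  have k49 : ω.K49 N := E.kf49 N hIH h1 h3 hg mok tf transfer epit ar k48
  exact R.krLoc N h1 k47 k48 k49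

/-- The Chapter-5 fine edge composes to the coarse edge `Nodes.E_Ch5` with the SAME premises. [claim: KalethaMinguezShinWhite2014, under-review] -/
theorem ch5_of_fine (E : ω.FineEdges ν) (R : ω.Readings ν) : ν.E_Ch5 := by
  intro N _hIH h1 h3 hloc hlir mok t164
  exact R.kr5 N (E.kf50 N h1 h3 hloc hlir mok t164)

/-- The paper's induction re-run on the fine edges, in the printed order inside rank N (§§4.1–4.3,
Chapter 2, §4.4, Chapter 3, §§4.5–4.9, Chapter 5): every chapter output and the proved scope at every
rank from the fine edges, the unrefined edge `E_Ch1` and the SAME external nodes as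
`Nodes.everything_of_chapterEdges`. [claim: KalethaMinguezShinWhite2014, under-review] -/
theorem everything_of_fine (E : ω.FineEdges ν) (R : ω.Readings ν) (c1 : ν.E_Ch1)
    (mok : ν.MokMain) (gl : ν.GL_inner) (transfer : ν.Transfer) (fl : ν.FL) (tf : ν.TF_analytic)
    (epit : ν.EPIT_published) (globi : ν.Glob_inputs) (ar : ν.Ar_args) (stabOrd : ν.StabOrdI) (t164 : ν.T164) :
    ∀ N, ν.Everything N := by
  refine Arthur2013.Nodes.strongInduction ?_
  intro N ih
  have hIH : ν.IH N := fun N' h => (ih N' h).2.2.2.2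
  have h1 : ν.Ch1 N := c1 N mok gl transfer epit t164
  have h2 : ν.Ch2 N := ω.ch2_of_fine ν E R N hIH h1 t164 mok tf transfer epit ar globi
  have hg : ν.Glob N := ω.glob_of_fine ν E R N hIH h1 h2 mok tf globi epit transfer ar
  have h3 : ν.Ch3 N := ω.ch3_of_fine ν E R N hIH h1 h2 mok stabOrd tf gl transfer fl epit ar
  have hlir : ν.LIRg N := ω.lir_of_fine ν E R N hIH h1 h2 h3 hg mok tf transfer epit ar
  have hloc : ν.T161g N := ω.loc_of_fine ν E R N hIH h1 h2 h3 hg hlir mok tf transfer epit ar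
  have h5 : ν.T171p N := ω.ch5_of_fine ν E R N hIH h1 h3 hloc hlir mok t164
  exact ⟨h1, hg, h2, h3, hloc, hlir, h5⟩

/-- Fine edges + `E_Ch1` + supply edges + leaves (grouped by 2026 status) ⟹ everything the paper proves, at every rank. [claim: KalethaMinguezShinWhite2014, under-review] -/
theorem everything_of_leaves_fine (E : ω.FineEdges ν) (R : ω.Readings ν) (c1 : ν.E_Ch1)
    (S : ν.SupplyEdges) (I : ν.ImportedLeaves) (P : ν.PublishedLeaves) (U : ν.UnwrittenLeaves) :
    ∀ N, ν.Everything N :=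
  ω.everything_of_fine ν E R c1 I.mok P.gl P.transfer P.fl P.tf P.epit P.globi P.arArgs
    (S.stabOrd P.fl P.wfl_split U.wfl_general P.stf P.transfer) (S.t164 P.gl P.transfer P.epit)

/-- MAIN BOOKKEEPING THEOREM OF THE REFINEMENT.  Fine edges + readings + `E_Ch1` + the supply edges +
EXACTLY the three leaf bundles of the companion give the proved scope `Scope N` at every rank: the
result-level refinement of Chapters 2–5 introduces no new leaf. [claim: KalethaMinguezShinWhite2014, under-review] -/
theorem scope_of_leaves_fine (E : ω.FineEdges ν) (R : ω.Readings ν) (c1 : ν.E_Ch1)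
    (S : ν.SupplyEdges) (I : ν.ImportedLeaves) (P : ν.PublishedLeaves) (U : ν.UnwrittenLeaves) :
    ∀ N, ν.Scope N :=
  fun N => (ω.everything_of_leaves_fine ν E R c1 S I P U N).2.2.2.2

/-- As main.tex l.69 phrases it: granted the fine edges, Mok's main results and the published inputs,
the proved scope is conditional exactly on the general weighted fundamental lemma — which enters at
waypoint K31 (§3.1) and propagates through Chapter 3 into the GLOBAL proofs of the LOCAL theorems
(§4.6, §4.9). [claim: KalethaMinguezShinWhite2014, under-review] -/
theorem scope_conditional_form_fine (E : ω.FineEdges ν) (R : ω.Readings ν) (c1 : ν.E_Ch1)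
    (S : ν.SupplyEdges) (I : ν.ImportedLeaves) (P : ν.PublishedLeaves) :
    ν.WFL_general → ∀ N, ν.Scope N :=
  fun h => ω.scope_of_leaves_fine ν E R c1 S I P ⟨h⟩

/-- FULL STATEMENTS from the fine edges: in addition the two unwritten sequels and Appendix A, through
the companion's deferral edge `E_Full`. [claim: KalethaMinguezShinWhite2014, under-review] -/
theorem full_of_leaves_fine (E : ω.FineEdges ν) (R : ω.Readings ν) (c1 : ν.E_Ch1)
    (S : ν.SupplyEdges) (I : ν.ImportedLeaves) (P : ν.PublishedLeaves) (U : ν.UnwrittenLeaves)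
    (Q : ν.UnwrittenSequels) : ∀ N, ν.Full N :=
  fun N => S.full Q.kmsA Q.kmsB (S.appA P.aubert P.tf) N (ω.everything_of_leaves_fine ν E R c1 S I P U N)

/-- The four exact compositions, bundled: the fine edges imply the coarse edges of Chapter 3, §§4.5–4.6,
§§4.7–4.9 and Chapter 5 as filed in the companion. [claim: KalethaMinguezShinWhite2014, under-review] -/
theorem coarse_of_fine (E : ω.FineEdges ν) (R : ω.Readings ν) :
    ν.E_Ch3 ∧ ν.E_Ch4lir ∧ ν.E_Ch4loc ∧ ν.E_Ch5 :=
  ⟨ω.ch3_of_fine ν E R, ω.lir_of_fine ν E R, ω.loc_of_fine ν E R, ω.ch5_of_fine ν E R⟩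

end Waypoints

end Literature.NumberTheory.Automorphic.KMSW2014
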